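import Literature.NumberTheory.GaloisCohomology.Howard2004.FiniteSingularEvaluation
import Literature.NumberTheory.GaloisRepresentations.GaloisCohomologyScalarActionLocalConditions
import HarnessLib

/-!
# Howard 2004, Prop. 1.1.7 / 1.1.9, `R`-LINEARLY: `H¹_f(K_v, T) ≃ₗ[R] T` and `H¹_s(K_v, T) ≃ₗ[R] T` by
# evaluation, for a module with trivial `Γ_{K_v}`-action (proofs file)

Topic `NumberTheory/GaloisCohomology/Howard2004` (sequel to `FiniteSingularEvaluation`: `evalClass`, `singularEval`,
`evalClass_bijective_unramified`, `singularEval_bijective`; and to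
`GaloisRepresentations/GaloisCohomologyScalarActionLocalConditions`: the functorial `R`-module structure
`moduleH1`, `unramifiedSubmodule`, `moduleSingularQuotient`).  THEOREMS ONLY: no definition, no named fact, no
instance, no `sorry`.

B. Howard, *The Heegner point Kolyvagin system*, Compositio Math. 140 (2004), Prop. 1.1.7 (= arXiv:1202.6340
Prop. 2.1.7, p. 5 L129–141): «There are canonical isomorphisms `H¹_f(K_v, T) ≅ T/(Frob_v − 1)T`,
`H¹_s(K_v, T) ⊗ k_v^× ≅ T^{Frob_v = 1}`», and Prop. 1.1.9 (p. 6 L17–25): at a degree-two prime with `Frob_λ`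
trivial on `T`, «`H¹_f(K_λ, T)` and `H¹_tr(K_λ, T)` are free rank two `R`-modules» (§1.5, p. 9 L105–108: «By H.0
and Proposition 1.1.9 … the local conditions `H¹_f(K_λ, T)` and `H¹_tr(K_λ, T)` are free rank two `R`-modules»).
The tree has the two evaluation bijections as additive maps (`FiniteSingularEvaluation`); this file records that
they are `R`-LINEAR for Howard's `R`-module structure on `H¹` (the functorial `moduleH1` of an `R`-linear
module), hence `R`-linear equivalences:

* `evalClass_scalarMapH1` — `ev_γ(H¹(r•) c) = r • ev_γ(c)` (`(r • z)(γ) = r • z(γ)` on cocycles);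
* **`nonempty_unramifiedSubmodule_linearEquiv`** — `H¹_ur(F, N) ≃ₗ[R] N` agreeing with evaluation at a
  Frobenius lift (`N` finite, trivial action); so with H.0 (`T^{(k)} ≅ R_k²`), `H¹_f(K_λ, T^{(k)})` is free of
  rank two — the input `ef` of `Literature/Algebra/Module/LagrangianSubmodulesSplitPairing`;
* `singularEval_smul`, **`nonempty_singularQuotient_linearEquiv`** — `H¹_s(F, N) ≃ₗ[R] N` agreeing with
  evaluation at a tame generator (`(q − 1)·N = 0`, `N` finite, trivial action).
Not here: the transverse condition (`H¹_tr ≅ T`, the complement half of Prop. 1.1.9).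

Cell `pub/bsd-print-x9`, G87 = Howard 2004 Thm. 1.6.1 (print leaf `stub_h161` of stmt-BirchSwinnertonDyer-22642);
seat `bsd-line-x9-p1-w3` g14, brick (SPLIT-LIN).  BSD is not proved by any of this.

References: [Howard2004HeegnerKolyvagin] Prop. 1.1.7, Prop. 1.1.9, §1.5 (arXiv:1202.6340 pp. 5–6, 9);
[MazurRubinMemoirs2004] Lemma 1.2.1; [SerreGaloisCohomology1997] I §2.2, I §2.3.
-/

set_option autoImplicit false

noncomputable section

open Function NumberField IsDedekindDomain Field

namespace Literature.NumberTheory.GaloisCohomology.Howard2004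

open Literature.NumberTheory.GaloisRepresentations
open Literature.NumberTheory.GaloisRepresentations.DiscreteGaloisModule
open Literature.NumberTheory.GaloisRepresentations.IsNonarchimedeanLocalField

section Local

variable {F : Type} [Field F] [ValuativeRel F] [TopologicalSpace F] [IsNonarchimedeanLocalField F]
  {N : Type} [AddCommGroup N] [TopologicalSpace N] [DiscreteTopology N]
  {R : Type} [CommRing R] [Module R N]

/-! ## §1 Evaluation commutes with the scalars -/

omit [ValuativeRel F] [TopologicalSpace F] [IsNonarchimedeanLocalField F] in
/-- **`ev_γ (H¹(r•) c) = r • ev_γ c`**: evaluation at `γ` of classes of a module with trivial action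
commutes with the functorial scalar action (`(r • z)(γ) = r • z(γ)`).
[cite: Howard2004HeegnerKolyvagin, Prop. 1.1.7 (arXiv:1202.6340 Prop. 2.1.7, p. 5 L129–138)]
[cite: SerreGaloisCohomology1997, I §2.2] -/
theorem evalClass_scalarMapH1 (ρ : DiscreteGaloisModule F N)
    (htriv : ∀ (σ : absoluteGaloisGroup F) (x : N), ρ σ x = x) (hρ : ρ.IsScalarLinear R)
    (γ : absoluteGaloisGroup F) (r : R) (c : galoisCohomology ρ 1) :
    evalClass ρ htriv γ (galoisCohomology.scalarMapH1 ρ hρ r c) = r • evalClass ρ htriv γ c := by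
  obtain ⟨z, rfl⟩ := oneCocycleClass_surjective ρ.toTopRep c
  rw [galoisCohomology.scalarMapH1_oneCocycleClass, evalClass_oneCocycleClass, evalClass_oneCocycleClass,
    galoisCohomology.scalarCocycle_apply]

omit [ValuativeRel F] [TopologicalSpace F] [IsNonarchimedeanLocalField F] in
/-- The same read with the module structure `moduleH1 ρ hρ`: `ev_γ (r • c) = r • ev_γ c`.
[cite: Howard2004HeegnerKolyvagin, Prop. 1.1.7 (arXiv:1202.6340 Prop. 2.1.7, p. 5 L129–138)] -/
theorem evalClass_smul (ρ : DiscreteGaloisModule F N)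
    (htriv : ∀ (σ : absoluteGaloisGroup F) (x : N), ρ σ x = x) (hρ : ρ.IsScalarLinear R)
    (γ : absoluteGaloisGroup F) (r : R) (c : galoisCohomology ρ 1) :
    evalClass ρ htriv γ (letI := galoisCohomology.moduleH1 ρ hρ; r • c) = r • evalClass ρ htriv γ c :=
  evalClass_scalarMapH1 ρ htriv hρ γ r c

/-! ## §2 `H¹_ur(F, N) ≃ₗ[R] N` -/

/-- **`H¹_f(K_v, T) ≃ₗ[R] T` by evaluation at a Frobenius lift** (trivial action, `T` finite): an `R`-linear
equivalence from the unramified submodule (functorial `R`-structure) onto `N`, agreeing with `evalClass` at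
`φ`.  Howard: «`H¹_f(K_λ, T)` is a free rank two `R`-module» (with H.0, `T ≅ R²`).
[cite: Howard2004HeegnerKolyvagin, Prop. 1.1.7 and Prop. 1.1.9 (arXiv:1202.6340 p. 5 L129–138, p. 6 L17–25)] -/
theorem nonempty_unramifiedSubmodule_linearEquiv [Finite N] (ρ : DiscreteGaloisModule F N)
    (htriv : ∀ (σ : absoluteGaloisGroup F) (x : N), ρ σ x = x) (hρ : ρ.IsScalarLinear R)
    {φ : absoluteGaloisGroup F} (hφ : IsFrobPow φ 1) :
    letI := galoisCohomology.moduleH1 ρ hρ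
    ∃ e : ↥(ρ.unramifiedSubmodule hρ) ≃ₗ[R] N,
      ∀ c : ↥(ρ.unramifiedSubmodule hρ), e c = evalClass ρ htriv φ (c : galoisCohomology ρ 1) := by
  letI := galoisCohomology.moduleH1 ρ hρ
  -- the `R`-linear map
  let f : ↥(ρ.unramifiedSubmodule hρ) →ₗ[R] N :=
    { toFun := fun c => evalClass ρ htriv φ (c : galoisCohomology ρ 1)
      map_add' := fun c c' => by
        rw [Submodule.coe_add, map_add]
      map_smul' := fun r c => by
        rw [Submodule.coe_smul, RingHom.id_apply]
        exact evalClass_smul ρ htriv hρ φ r _ }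
  have hf : Function.Bijective f := evalClass_bijective_unramified ρ htriv hφ
  exact ⟨LinearEquiv.ofBijective f hf, fun c => rfl⟩

/-! ## §3 `H¹_s(F, N) ≃ₗ[R] N` -/

/-- **`sev_{σ₀} (r • c̄) = r • sev_{σ₀} c̄`** on the singular quotient with its induced `R`-module structure
(`moduleSingularQuotient`). [cite: Howard2004HeegnerKolyvagin, Prop. 1.1.7 (arXiv:1202.6340 p. 5 L138–141)] -/
theorem singularEval_smul (ρ : DiscreteGaloisModule F N)
    (htriv : ∀ (σ : absoluteGaloisGroup F) (x : N), ρ σ x = x) (hρ : ρ.IsScalarLinear R)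
    (σ₀ : absInertia F) (r : R) (c : ρ.SingularQuotient) :
    singularEval ρ htriv σ₀ (letI := ρ.moduleSingularQuotient hρ; r • c) = r • singularEval ρ htriv σ₀ c := by
  obtain ⟨c, rfl⟩ := QuotientAddGroup.mk_surjective c
  change singularEval ρ htriv σ₀ (letI := ρ.moduleSingularQuotient hρ; r • ρ.singularMap c) =
    r • singularEval ρ htriv σ₀ (ρ.singularMap c)
  rw [← DiscreteGaloisModule.singularMap_smul hρ r c, singularEval_singularMap, singularEval_singularMap]
  exact evalClass_smul ρ htriv hρ _ r c

/-- **`H¹_s(K_v, T) ≃ₗ[R] T` by evaluation at a tame generator `σ₀`** (trivial action, `T` finite,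
`(q_v − 1)·T = 0`): an `R`-linear equivalence from the singular quotient (induced `R`-structure) onto `N`,
agreeing with `singularEval`.  Howard: «`T ≅ H¹_s(K_v, T) ⊗ k_v^×`».
[cite: Howard2004HeegnerKolyvagin, Prop. 1.1.7 (arXiv:1202.6340 Prop. 2.1.7, p. 5 L138–141)]
[cite: MazurRubinMemoirs2004, Lemma 1.2.1] -/
theorem nonempty_singularQuotient_linearEquiv [Finite N] (ρ : DiscreteGaloisModule F N)
    (htriv : ∀ (σ : absoluteGaloisGroup F) (x : N), ρ σ x = x) (hρ : ρ.IsScalarLinear R)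
    {σ₀ : absInertia F} (hσ₀ : IsTameGenerator σ₀) (hq : ∀ x : N, (residueFieldCard F - 1) • x = 0) :
    letI := ρ.moduleSingularQuotient hρ
    ∃ e : ρ.SingularQuotient ≃ₗ[R] N, ∀ c, e c = singularEval ρ htriv σ₀ c := by
  letI := ρ.moduleSingularQuotient hρ
  let f : ρ.SingularQuotient →ₗ[R] N :=
    { toFun := singularEval ρ htriv σ₀
      map_add' := map_add _
      map_smul' := fun r c => singularEval_smul ρ htriv hρ σ₀ r c }
  have hf : Function.Bijective f := singularEval_bijective ρ htriv hσ₀ hq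
  exact ⟨LinearEquiv.ofBijective f hf, fun c => rfl⟩

end Local

end Literature.NumberTheory.GaloisCohomology.Howard2004

end
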